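import Mathlib.GroupTheory.FreeGroup.CyclicallyReduced
import Mathlib.Topology.Algebra.ClopenNhdofOne
import Literature.IUT.HodgeTheaters.TemperedCoveringsProp24Sub
import Literature.IUT.HodgeTheaters.TemperedCoveringsFreeModel
import Literature.IUT.HodgeTheaters.ProfiniteCompletionFiniteIndexIso
import HarnessLib

/-!
# [IUTchI] Prop. 2.4 (i): the SUB-DAG tower of levels is INHABITED at the free consistency model — NV witness

Mochizuki, *Inter-universal Teichmüller theory I: construction of Hodge theaters*, kurims manuscript
(May 2020), §2, Proposition 2.4 (i), proof p. 50 l. 25–42 ([IUTchI] Prop 2.4 p.50)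
[claim: Mochizuki2012, status: disputed].  NON-VACUITY WITNESS (cell row «NV-L5/Prop24Tower», plan
§4(iii)): abc-iut-w5-d119's level-tower record `StableCurveTemperedData.Prop24Tower`
(`TemperedCoveringsProp24Sub.lean`: "the finite index characteristic open subgroups `J ⊆ Δ^tp_X`", p. 50
l. 27, with `Ĵ ⊆ Π̂_X`, the level pairs `Π^tp_{𝔾_J} ↪ Π̂_{𝔾_J}` and the surjections `J ↠ Π^tp_{𝔾_J}`,
`Ĵ ↠ Π̂_{𝔾_J}`) had NO producer in the kernel (abc-iut-w5-d197, INHABITATION-CENSUS-L5 v1).  Here it is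
inhabited at abc-iut-L5-d4's HONEST consistency datum `StableCurveTemperedData.FreeModel.toy`
(`TemperedCoveringsFreeModel.lean`: the free group `F₂`, discrete, densely and injectively embedded in its
profinite completion `F̂₂`; curve level = graph level, `G_k = 1`, no cusps — the datum at which
`toy.Cor23ii` / `toy.Cor23v` are already theorems), by the GENUINE tower of ALL levels:

* levels `I :=` the finite-index normal subgroups `N ⊴ F₂` (Mathlib `FiniteIndexNormalSubgroup`);
* `Ĵ_N :=` the closure of `η(N)` in `F̂₂` (an open normal subgroup of index `[F₂ : N]`, abc-iut-L5's
  `ProfiniteCompletionFiniteIndexIso.lean`), so that the level `J_N := Δ^tp_X ∩ ι⁻¹(Ĵ_N)` IS `N`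
  ("`Ĵ ∩ Δ^tp_X = J`", p. 50 l. 33 — `toCompletion_mem_topologicalClosure_map_iff`);
* `𝔾_{J_N} :=` the pair `N ↪ Ĵ_N` itself ("curve level = graph level", exactly as in the datum), with
  `J_N ↠ Π^tp_{𝔾_J}` and `Ĵ_N ↠ Π̂_{𝔾_J}` the identities.

MAIN THEOREM `exists_prop24Tower_model`: this tower satisfies SIMULTANEOUSLY every named sub-node of the
SUB-DAG of Prop. 2.4 (i) — `LevelsClosed`, `LevelsInDelta`, `LevelsNormal`, `LevelsOpen`, `LevelsCofinal`
(open subgroups of a profinite completion are refined by closures of finite-index normal subgroups of the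
dense discrete group), `Translate` ("`F̂ = F·Ĝ`", `exists_inv_mul_mem_closure`), `DetectsTempered`,
`SpecializationAb`, `LevelsDetect`, `Prop21Levels` — hence the typed composition
`Prop24Tower.prop24i_of_tower` FIRES at a datum (`prop24i_model`).

HONEST LABEL (`_model` on the tempered/profinite axis; DEGENERATE on the compact-subgroup axis, said
here and in every docstring concerned): a discrete torsion-free group has NO nontrivial compact subgroup
(`subgroup_eq_bot_of_isCompact`), so the `Λ`-quantified sub-nodes `LevelsDetect`, `Prop21Levels` and the
conclusion `toy.Prop24i` hold VACUOUSLY at this datum, and the pro-`Σ` Sylow input of Prop. 2.4 (iii)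
FAILS there (`not_hasCompactProSigma`) — the free model exercises the LEVEL BOOKKEEPING and the
tempered-vs-profinite detection of the printed proof, not its arithmetic compact subgroups.  Consumer
shape: abc-iut-w5-d121's `cor24_i'_of_levels_byName` binds `Tw : D.Prop24Tower` with `Tw.LevelsNormal`
and cofinality — instantiated here BY NAME at `D := toy`.

Proof-only (no `def`/`instance`/`structure`: the tower is built inside the theorem terms); plain
profinite group theory over the landed interfaces, consumed by name; nothing here is the arithmetic
situation of p. 46 and nothing bears on [IUTchIII] Cor. 3.12.  Instantiated ≠ endorsed; typed ≠ proved
for the arithmetic statements themselves.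
-/

namespace Literature.IUT.HodgeTheaters

namespace StableCurveTemperedData

namespace FreeModel

open Topology
open Literature.IUT.HodgeTheaters.ProfiniteCompletion

/-! ### The compact-subgroup axis of the free model is EMPTY (honesty lemmas) -/

/-- In the free model every compact subgroup `Λ` of (any subgroup `S` of) the discrete tempered group
`Π^tp_X = F₂` is TRIVIAL: compact + discrete ⇒ finite, and `F₂` is torsion-free.  This is WHY the
`Λ`-quantified sub-nodes of [IUTchI] Prop. 2.4 hold only vacuously at this datum.
[cite: Mochizuki2012, Prop 2.4(i) p.50] [claim: Mochizuki2012, status: disputed] -/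
theorem subgroup_eq_bot_of_isCompact (S : Subgroup F2) (Λ : Subgroup S)
    (hΛ : IsCompact (Λ : Set S)) : Λ = ⊥ := by
  haveI : IsMulTorsionFree F2 := (inferInstance : IsMulTorsionFree (FreeGroup (Fin 2)))
  have hfin : (Λ : Set S).Finite := hΛ.finite_of_discrete
  haveI : Finite Λ := hfin.to_subtype
  refine (Subgroup.eq_bot_iff_forall _).mpr fun x hx => ?_
  have h1 : IsOfFinOrder (⟨x, hx⟩ : Λ) := isOfFinOrder_of_finite _
  have h2 : IsOfFinOrder ((x : S) : F2) := (S.subtype.comp Λ.subtype).isOfFinOrder h1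
  exact Subtype.ext h2.eq_one'

/-- The pro-`Σ` Sylow input `HasCompactProSigma` of [IUTchI] Prop. 2.4 (iii) ("an infinite compact pro-`Σ`
subgroup `V ⊆ Δ^tp_X`", p. 51 l. 15–18) FAILS at the free model — the honest degeneracy axis of this
witness: `Prop24Tower.prop24iii_of_tower` can NOT be fired here.
[cite: Mochizuki2012, Prop 2.4(iii) p.51] [claim: Mochizuki2012, status: disputed] -/
theorem not_hasCompactProSigma : ¬ toy.HasCompactProSigma := by
  rintro ⟨V, hVc, hVinf, -, -⟩
  have hV : V = ⊥ := subgroup_eq_bot_of_isCompact _ V hVc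
  rw [hV, Subgroup.coe_bot] at hVinf
  exact hVinf (Set.finite_singleton _)

/-! ### Cofinality core: open subgroups of `F̂₂` versus finite-index normal subgroups of `F₂` -/

/-- **Cofinality core** ("by allowing `J` to vary", p. 50 l. 40): every open subgroup `V` of the profinite
completion `F̂₂` contains the closure of `η(N)` for some finite-index NORMAL subgroup `N ⊴ F₂` — take an
open normal subgroup `W ⊆ V` of the profinite group `F̂₂` (Mathlib
`ProfiniteGrp.exist_openNormalSubgroup_sub_open_nhds_of_one`) and `N := η⁻¹(W)`.
[cite: Mochizuki2012, Prop 2.4(i) p.50] [claim: Mochizuki2012, status: disputed] -/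
theorem exists_finiteIndexNormal_closure_le (V : Subgroup Hat) (hV : IsOpen (V : Set Hat)) :
    ∃ N : FiniteIndexNormalSubgroup F2,
      (N.toSubgroup.map (toCompletion F2)).topologicalClosure ≤ V := by
  obtain ⟨W, hW⟩ := ProfiniteGrp.exist_openNormalSubgroup_sub_open_nhds_of_one hV V.one_mem
  haveI : W.toSubgroup.FiniteIndex := Subgroup.finiteIndex_of_finite_quotient
  refine ⟨FiniteIndexNormalSubgroup.comap (toCompletion F2)
    (FiniteIndexNormalSubgroup.ofSubgroup W.toSubgroup), ?_⟩
  rw [FiniteIndexNormalSubgroup.toSubgroup_comap, FiniteIndexNormalSubgroup.toSubgroup_ofSubgroup]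
  refine le_trans (Subgroup.topologicalClosure_minimal _ (Subgroup.map_comap_le _ _)
    W.toOpenSubgroup.isClosed) ?_
  intro x hx
  exact hW hx

/-! ### The tower and the joint satisfaction of the SUB-DAG of Prop. 2.4 (i) -/

/-- **NV-L5 / Prop24Tower, main theorem.**  At the free consistency datum `toy` (`F₂ ↪ F̂₂`) there is a
tower of levels `T : toy.Prop24Tower` — levels = ALL finite-index normal `N ⊴ F₂`, `Ĵ_N = closure η(N)`,
`𝔾_{J_N} = (N ↪ Ĵ_N)`, `J_N ↠ Π^tp_{𝔾_J}` and `Ĵ_N ↠ Π̂_{𝔾_J}` the identities — satisfying SIMULTANEOUSLY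
the ten named sub-nodes of the SUB-DAG of [IUTchI] Prop. 2.4 (i) (abc-iut-w5-d119,
`TemperedCoveringsProp24Sub.lean`): closed / in `Δ̂` / normal / open / COFINAL levels, (L3) `Translate`,
(INV) `DetectsTempered`, (L2b) `SpecializationAb`, and — VACUOUSLY, since `F₂` has no nontrivial compact
subgroup (`subgroup_eq_bot_of_isCompact`) — (L2) `LevelsDetect` and (L1) `Prop21Levels`.  GENUINE on the
tempered/profinite axis (cofinality = open subgroups of `F̂₂` are refined by closures of finite-index
normal subgroups of the dense `F₂`; translate = `F̂₂ = η(F₂)·Ĵ`); DEGENERATE on the compact-subgroup axis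
(said).  [cite: Mochizuki2012, Prop 2.4(i) p.50] [claim: Mochizuki2012, status: disputed] -/
theorem exists_prop24Tower_model :
    ∃ T : toy.Prop24Tower,
      T.LevelsClosed ∧ T.LevelsInDelta ∧ T.LevelsNormal ∧ T.LevelsOpen ∧ T.LevelsCofinal ∧
      T.Translate ∧ T.DetectsTempered ∧ T.SpecializationAb ∧ T.LevelsDetect ∧ T.Prop21Levels := by
  refine ⟨
    { I := FiniteIndexNormalSubgroup F2
      Jhat := fun N => (N.toSubgroup.map (toCompletion F2)).topologicalClosure
      G := fun N =>
        { Sigma := {3}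
          SigmaHat := {3}
          sigma_subset := subset_rfl
          sigma_nonempty := ⟨3, rfl⟩
          sigmaHat_prime := by
            intro p hp
            rw [Set.mem_singleton_iff] at hp
            subst hp
            exact Nat.prime_three
          Tp := ↥N.toSubgroup
          Hat := ↥(N.toSubgroup.map (toCompletion F2)).topologicalClosure
          hatCompact := isCompact_iff_compactSpace.mp
            (Subgroup.isClosed_topologicalClosure _).isCompact
          ι := ((toCompletion F2).comp N.toSubgroup.subtype).codRestrict _ fun x =>
            Subgroup.le_topologicalClosure _ (Subgroup.mem_map.mpr ⟨x, x.2, rfl⟩)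
          ι_continuous := continuous_of_discreteTopology
          ι_injective := fun a b h =>
            Subtype.ext (ι_injective (congrArg Subtype.val h :))
          TpH := ⊤
          HatH := ⊤
          tpH_le := le_top }
      πtp := fun N =>
        (toy.DeltaTp.subtype.comp (Subgroup.subtype _)).codRestrict N.toSubgroup fun x =>
          (toCompletion_mem_topologicalClosure_map_iff N.toSubgroup _).mp x.2
      πtp_continuous := fun N => continuous_of_discreteTopology
      πtp_surjective := fun N n =>
        ⟨⟨⟨(n : F2), by simp [MonoidHom.mem_ker]⟩,
          (toCompletion_mem_topologicalClosure_map_iff N.toSubgroup _).mpr n.2⟩, rfl⟩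
      πhat := fun N => MonoidHom.id _
      comp := fun N x hx => rfl }, ?_, ?_, ?_, ?_, ?_, ?_, ?_, ?_, ?_, ?_⟩
  · -- LevelsClosed: `Ĵ_N` is a closure
    intro N
    exact Subgroup.isClosed_topologicalClosure _
  · -- LevelsInDelta: `Δ̂_X = Ker(F̂₂ → 1)` is everything
    intro N x _
    exact MonoidHom.mem_ker.mpr (Subsingleton.elim _ _)
  · -- LevelsNormal: closures of `η(N)`, `N ⊴ F₂` of finite index, are normal
    intro N
    haveI := normal_topologicalClosure_map N.toSubgroup
    dsimp only
    infer_instance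
  · -- LevelsOpen: `Ĵ_N` is open in `F̂₂` (index `[F₂ : N]`)
    intro N
    show IsOpen _
    rw [Subgroup.coe_subgroupOf]
    exact (isOpen_topologicalClosure_map N.toSubgroup).preimage continuous_subtype_val
  · -- LevelsCofinal
    intro U hU
    have hΔ : IsOpen ((toy.DeltaHat : Subgroup toy.PiHat) : Set toy.PiHat) := by
      have : (toy.DeltaHat : Subgroup toy.PiHat) = ⊤ := MonoidHom.ker_one
      rw [this]
      exact isOpen_univ
    have hV : IsOpen ((U.map toy.DeltaHat.subtype : Subgroup toy.PiHat) : Set toy.PiHat) := by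
      rw [Subgroup.coe_map]
      exact hΔ.isOpenEmbedding_subtypeVal.isOpenMap _ hU
    obtain ⟨N, hN⟩ := exists_finiteIndexNormal_closure_le _ hV
    refine ⟨N, fun x hx => ?_⟩
    obtain ⟨u, hu, hux⟩ := Subgroup.mem_map.mp (hN (Subgroup.mem_subgroupOf.mp hx))
    have hux' : u = x := Subtype.ext hux
    exact hux' ▸ hu
  · -- Translate: `F̂₂ = η(F₂) · Ĵ_N`
    intro N γ
    obtain ⟨t, ht⟩ := exists_inv_mul_mem_closure N.toSubgroup γ
    exact ⟨t, mem_topologicalClosure_map_iff.mpr ht⟩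
  · -- DetectsTempered: `Ĵ_N ↠ Π̂_{𝔾_J}` is the identity, so "tempered modulo its kernel" is "tempered"
    rintro W ⟨N₀, hN₀⟩ γ h
    obtain ⟨t, ht, h1⟩ := h N₀ hN₀
    have h2 : (toy.ιX t)⁻¹ * γ = 1 := congrArg Subtype.val h1
    rw [inv_mul_eq_one] at h2
    exact ⟨t, h2⟩
  · -- SpecializationAb: `J_N ↠ Π^tp_{𝔾_J}` is the identity, so its kernel is trivial
    intro N x hx h1
    rintro ⟨A, _, _, χ, -, -, hχ⟩
    apply hχ
    have hx1 : ((x : toy.DeltaTp) : toy.PiTp) = 1 := congrArg Subtype.val h1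
    have key : toy.ιX ((x : toy.DeltaTp) : toy.PiTp) = 1 := by rw [hx1, map_one]
    convert map_one χ using 2
    exact Subtype.ext (Subtype.ext key)
  · -- LevelsDetect: VACUOUS — no nontrivial compact `Λ ⊆ Δ^tp_X = F₂`
    intro Λ hΛc hΛne _
    exact absurd (subgroup_eq_bot_of_isCompact _ Λ hΛc) hΛne
  · -- Prop21Levels: VACUOUS at every level for the same reason (`Π^tp_{𝔾_J} = N ⊆ F₂` discrete)
    intro N
    refine ⟨fun Λ hΛc hΛne γ _ => ?_⟩
    exact absurd (subgroup_eq_bot_of_isCompact N.toSubgroup Λ hΛc) hΛne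

/-- **NV-L5 / Prop24Tower**: the record `StableCurveTemperedData.Prop24Tower` is INHABITED at the free
consistency datum (`_model` on the tempered/profinite axis; see `exists_prop24Tower_model` for the tower
and its honesty label). [cite: Mochizuki2012, Prop 2.4(i) p.50] [claim: Mochizuki2012, status: disputed] -/
theorem nonempty_prop24Tower_model : Nonempty toy.Prop24Tower :=
  let ⟨T, _⟩ := exists_prop24Tower_model
  ⟨T⟩

/-- The typed SUB-DAG composition `Prop24Tower.prop24i_of_tower` FIRES at the free model: abc-iut-L5-t1's
predicate `Prop24i` holds for `toy` — VACUOUSLY in content (no nontrivial compact `Λ ⊆ Δ^tp_X`, cf.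
`subgroup_eq_bot_of_isCompact`), but through the printed chain (L1)+(L2)+(L3)+(INV) at a datum where each
link is a kernel theorem. [cite: Mochizuki2012, Prop 2.4(i) p.50] [claim: Mochizuki2012, status: disputed] -/
theorem prop24i_model : toy.Prop24i := by
  obtain ⟨T, hc, -, -, -, -, hL3, hINV, -, hL2, h21⟩ := exists_prop24Tower_model
  exact T.prop24i_of_tower hc h21 hL2 hL3 hINV

end FreeModel

end StableCurveTemperedData

end Literature.IUT.HodgeTheaters
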